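import Summits.Ventures.Crystal3D.Theorems.StickyWulffConstantGenericWallFloorFramePropagationHcp
import HarnessLib

/-!
# The axis of a mirror-twin pair is unique (crux `GenericWallFloor`, line `WallLedgerG`; the
# «unique common frame» of the co-axial charge in `CoaxialWallLaw` / `TextureLiminf`)

HONEST FRAMING. Part of the venture `Summits/Ventures/Crystal3D` (cell `crystal3d-full`), helper
`--supports` the crux `GenericWallFloor` (stmt-Ventures-19480) of `route-Ventures-StickyWulffConstant`,
registered line `WallLedgerG` (planner cf-p1 gen 16).  Companion of `…CoaxialCriterion` /
`…CoaxialIff`: a co-axial pair of DIFFERENT lattices is `{L·Λ₀, L·Λ₀⁻}` in a common frame `L`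
(`Λ₀⁻ = B(−1)` the `e₃`-mirror twin).  This file shows the frame's AXIS is then determined up to
sign: if `{L·Λ₀, L·Λ₀⁻} = {L'·Λ₀, L'·Λ₀⁻}` (either matching) then `L' e₃ = ± L e₃`
(`twin_axis_unique`).  Core (`axis_of_frameClass_fixed`): an isometry `M` permuting `{Λ₀, Λ₀⁻}` maps
the common unit vectors — the in-layer hexagon, `apply_two_eq_zero_of_mem_fcc_inter_twin` — to
themselves, hence the layer plane to itself, hence `e₃ ↦ ± e₃`.  So the «shared stacking axis
`m = L e₃`» that the co-axial charge of the wall laws refers to is well defined for twin pairs.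

WHAT THIS IS NOT: for a pair of EQUAL lattices all four ⟨111⟩ axes are admissible frames (no
uniqueness); nothing about walls; rung F-C1 not moved.
-/

noncomputable section

namespace Summit.Ventures.Crystal3D.Theorems

open Literature.MathematicalPhysics.StatisticalMechanics
open scoped InnerProductSpace

/-- **Common unit vectors of `Λ₀` and its mirror twin are horizontal** (the Σ3 coincidence lattice
`Λ₀ ∩ Λ₀⁻` has the in-layer hexagon as its unit shell). -/
theorem apply_two_eq_zero_of_mem_fcc_inter_twin {x : EuclideanSpace ℝ (Fin 3)}
    (h₁ : x ∈ fccStacking 1 (Real.sqrt (2 / 3)))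
    (h₂ : x ∈ barlowStacking 1 (Real.sqrt (2 / 3)) (fun _ : ℤ => (-1 : ℤ))) (hx : ‖x‖ = 1) :
    x 2 = 0 := by
  have hH : (0 : ℝ) < Real.sqrt (2 / 3) := Real.sqrt_pos.2 (by norm_num)
  have h3 : (0 : ℝ) < Real.sqrt 3 := Real.sqrt_pos.2 (by norm_num)
  obtain ⟨K, I, J, rfl, hK⟩ := exists_site_of_unit_constε (ε := 1) (Or.inl rfl) h₁ hx
  obtain ⟨K', I', J', e⟩ := h₂
  have e2 := congrArg (fun q : EuclideanSpace ℝ (Fin 3) => q 2) e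
  have e1 := congrArg (fun q : EuclideanSpace ℝ (Fin 3) => q 1) e
  simp only [barlowPos_apply_two] at e2
  have hKK : ((K : ℤ) : ℝ) = K' := by
    have : ((K : ℝ) - K') * Real.sqrt (2 / 3) = 0 := by nlinarith [e2]
    have := (mul_eq_zero.1 this).resolve_right hH.ne'
    linarith
  have hKZ : K' = K := by exact_mod_cast hKK.symm
  subst hKZ
  simp only [barlowPos_apply_one, haggLabel_constε] at e1
  push_cast at e1
  have e1' : (3 : ℝ) * ((J : ℝ) - J') = -2 * K' := by
    have : Real.sqrt 3 * (3 * ((J : ℝ) - J') + 2 * K') = 0 := by nlinarith [e1]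
    have := (mul_eq_zero.1 this).resolve_left h3.ne'
    linarith
  have e1Z : 3 * (J - J') = -2 * K' := by exact_mod_cast e1'
  have hK0 : K' = 0 := by rcases hK with h | h | h <;> omega
  rw [barlowPos_apply_two, hK0]; simp

/-- **An isometry permuting `{Λ₀, Λ₀⁻}` fixes the stacking axis up to sign.** -/
theorem axis_of_frameClass_fixed (M : EuclideanSpace ℝ (Fin 3) ≃ₗᵢ[ℝ] EuclideanSpace ℝ (Fin 3))
    (h : (M '' fccStacking 1 (Real.sqrt (2 / 3)) = fccStacking 1 (Real.sqrt (2 / 3)) ∧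
        M '' barlowStacking 1 (Real.sqrt (2 / 3)) (fun _ : ℤ => (-1 : ℤ)) =
          barlowStacking 1 (Real.sqrt (2 / 3)) (fun _ : ℤ => (-1 : ℤ))) ∨
      (M '' fccStacking 1 (Real.sqrt (2 / 3)) = barlowStacking 1 (Real.sqrt (2 / 3)) (fun _ : ℤ => (-1 : ℤ)) ∧
        M '' barlowStacking 1 (Real.sqrt (2 / 3)) (fun _ : ℤ => (-1 : ℤ)) =
          fccStacking 1 (Real.sqrt (2 / 3)))) :
    M (EuclideanSpace.single (2 : Fin 3) (1 : ℝ)) = EuclideanSpace.single (2 : Fin 3) (1 : ℝ) ∨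
    M (EuclideanSpace.single (2 : Fin 3) (1 : ℝ)) = -EuclideanSpace.single (2 : Fin 3) (1 : ℝ) := by
  obtain ⟨hg0, hg1, hg2, -⟩ := vertical_generator_apply
  obtain ⟨nu, nv, -⟩ := norm_barlowPos_generators isHaggSeq_const
  have hH : (0 : ℝ) < Real.sqrt (2 / 3) := Real.sqrt_pos.2 (by norm_num)
  have h3 : (0 : ℝ) < Real.sqrt 3 := Real.sqrt_pos.2 (by norm_num)
  set u₀ : EuclideanSpace ℝ (Fin 3) := barlowPos 1 (Real.sqrt (2 / 3)) constHagg 0 1 0 with hu₀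
  set v₀ : EuclideanSpace ℝ (Fin 3) := barlowPos 1 (Real.sqrt (2 / 3)) constHagg 0 0 1 with hv₀
  set f₀ : EuclideanSpace ℝ (Fin 3) := barlowPos 1 (Real.sqrt (2 / 3)) constHagg 1 0 0 with hf₀
  set g : EuclideanSpace ℝ (Fin 3) := f₀ - (1 / 3 : ℝ) • (u₀ + v₀) with hg
  clear_value g f₀ u₀ v₀
  -- images of common (in-layer) vectors are common, hence horizontal
  have common : ∀ w : EuclideanSpace ℝ (Fin 3), w ∈ fccStacking 1 (Real.sqrt (2 / 3)) →
      w ∈ barlowStacking 1 (Real.sqrt (2 / 3)) (fun _ : ℤ => (-1 : ℤ)) → ‖w‖ = 1 → (M w) 2 = 0 := by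
    intro w hw₁ hw₂ hw1
    have hn : ‖M w‖ = 1 := by rw [LinearIsometryEquiv.norm_map, hw1]
    rcases h with ⟨e₁, e₂⟩ | ⟨e₁, e₂⟩
    · exact apply_two_eq_zero_of_mem_fcc_inter_twin (e₁ ▸ ⟨w, hw₁, rfl⟩) (e₂ ▸ ⟨w, hw₂, rfl⟩) hn
    · exact apply_two_eq_zero_of_mem_fcc_inter_twin (e₂ ▸ ⟨w, hw₂, rfl⟩) (e₁ ▸ ⟨w, hw₁, rfl⟩) hn
  have hu₁ : u₀ ∈ fccStacking 1 (Real.sqrt (2 / 3)) := by rw [hu₀]; exact ⟨_, _, _, rfl⟩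
  have hu₂ : u₀ ∈ barlowStacking 1 (Real.sqrt (2 / 3)) (fun _ : ℤ => (-1 : ℤ)) := by
    rw [hu₀, barlowPos_inLayer_eq _ constHagg (fun _ : ℤ => (-1 : ℤ))]; exact ⟨_, _, _, rfl⟩
  have hv₁ : v₀ ∈ fccStacking 1 (Real.sqrt (2 / 3)) := by rw [hv₀]; exact ⟨_, _, _, rfl⟩
  have hv₂ : v₀ ∈ barlowStacking 1 (Real.sqrt (2 / 3)) (fun _ : ℤ => (-1 : ℤ)) := by
    rw [hv₀, barlowPos_inLayer_eq _ constHagg (fun _ : ℤ => (-1 : ℤ))]; exact ⟨_, _, _, rfl⟩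
  have ha2 := common u₀ hu₁ hu₂ nu
  have hb2 := common v₀ hv₁ hv₂ nv
  -- the images are in-layer sites of `Λ₀` (either case puts `M u₀` in `Λ₀ ∩ Λ₀⁻ ⊆ Λ₀`)
  have memΛ : ∀ w : EuclideanSpace ℝ (Fin 3), w ∈ fccStacking 1 (Real.sqrt (2 / 3)) →
      w ∈ barlowStacking 1 (Real.sqrt (2 / 3)) (fun _ : ℤ => (-1 : ℤ)) →
      barlowPos 1 (Real.sqrt (2 / 3)) constHagg 0 0 0 + M w ∈ barlowStacking 1 (Real.sqrt (2 / 3)) constHagg := by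
    intro w hw₁ hw₂
    rw [barlowPos_zero, zero_add]
    show M w ∈ fccStacking 1 (Real.sqrt (2 / 3))
    rcases h with ⟨e₁, -⟩ | ⟨-, e₂⟩
    · rw [← e₁]; exact ⟨w, hw₁, rfl⟩
    · rw [← e₂]; exact ⟨w, hw₂, rfl⟩
  obtain ⟨Ia, Ja, ha, hpa⟩ := exists_inLayer_of_horizontal isHaggSeq_const 0 0 0
    (by rw [LinearIsometryEquiv.norm_map, nu]) ha2 (memΛ u₀ hu₁ hu₂)
  obtain ⟨Ib, Jb, hb, hpb⟩ := exists_inLayer_of_horizontal isHaggSeq_const 0 0 0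
    (by rw [LinearIsometryEquiv.norm_map, nv]) hb2 (memΛ v₀ hv₁ hv₂)
  have hinner : (2 : ℤ) * (-Ia) * (-Ib) + (-Ia) * (-Jb) + (-Ja) * (-Ib) + 2 * (-Ja) * (-Jb) = 1 := by
    have e1 : ⟪M u₀, M v₀⟫_ℝ = 1 / 2 := by
      rw [LinearIsometryEquiv.inner_map_map, hu₀, hv₀, inner_inLayer]; push_cast; ring
    rw [ha, hb, inner_inLayer] at e1
    have : (2 : ℝ) * Ia * Ib + Ia * Jb + Ja * Ib + 2 * Ja * Jb = 1 := by linarith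
    have hZ : (2 : ℤ) * Ia * Ib + Ia * Jb + Ja * Ib + 2 * Ja * Jb = 1 := by exact_mod_cast this
    linarith [hZ]
  obtain ⟨hnpar, -⟩ := hexagonPair_decide _ hpa _ hpb hinner
  simp only [neg_mul_neg] at hnpar
  obtain ⟨a0, a1, -⟩ := barlowPos_inLayer_apply (Real.sqrt (2 / 3)) constHagg Ia Ja
  obtain ⟨b0, b1, -⟩ := barlowPos_inLayer_apply (Real.sqrt (2 / 3)) constHagg Ib Jb
  -- `M g` is vertical
  have hMg0 : (M g) 0 = 0 ∧ (M g) 1 = 0 := by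
    refine vertical_of_orthogonal (M g) (M u₀) (M v₀) ha2 hb2 ?_ ?_ ?_
    · rw [LinearIsometryEquiv.inner_map_map]
      have : ⟪g, u₀⟫_ℝ = g 0 * u₀ 0 + g 1 * u₀ 1 + g 2 * u₀ 2 := by
        simp [PiLp.inner_apply, Fin.sum_univ_three, mul_comm]
      rw [this, hg0, hg1, hu₀, (barlowPos_inLayer_apply _ constHagg 1 0).2.2]; ring
    · rw [LinearIsometryEquiv.inner_map_map]
      have : ⟪g, v₀⟫_ℝ = g 0 * v₀ 0 + g 1 * v₀ 1 + g 2 * v₀ 2 := by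
        simp [PiLp.inner_apply, Fin.sum_univ_three, mul_comm]
      rw [this, hg0, hg1, hv₀, (barlowPos_inLayer_apply _ constHagg 0 1).2.2]; ring
    · rw [ha, hb, a0, a1, b0, b1]
      have hne : ((Ia * Jb : ℤ) : ℝ) ≠ ((Ja * Ib : ℤ) : ℝ) := by exact_mod_cast hnpar
      push_cast at hne
      intro h0
      apply hne
      have : Real.sqrt 3 * ((Ia : ℝ) * Jb - Ja * Ib) = 0 := by nlinarith [h0]
      have := (mul_eq_zero.1 this).resolve_left h3.ne'
      linarith
  have hMg2 : (M g) 2 = Real.sqrt (2 / 3) ∨ (M g) 2 = -Real.sqrt (2 / 3) := by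
    have hn : ‖M g‖ ^ 2 = Real.sqrt (2 / 3) ^ 2 := by
      rw [LinearIsometryEquiv.norm_map, norm_sq_eq_fin3, hg0, hg1, hg2]; ring
    rw [norm_sq_eq_fin3, hMg0.1, hMg0.2] at hn
    have : ((M g) 2 - Real.sqrt (2 / 3)) * ((M g) 2 + Real.sqrt (2 / 3)) = 0 := by nlinarith [hn]
    rcases mul_eq_zero.1 this with h' | h'
    exacts [Or.inl (sub_eq_zero.1 h'), Or.inr (eq_neg_of_add_eq_zero_left h')]
  -- `e₃ = H⁻¹ g`
  have hge : EuclideanSpace.single (2 : Fin 3) (1 : ℝ) = (Real.sqrt (2 / 3))⁻¹ • g := by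
    ext l
    fin_cases l
    · simp [hg0]
    · simp [hg1]
    · simp [hg2]
  rw [hge, map_smul]
  rcases hMg2 with h' | h'
  · left
    ext l
    fin_cases l
    · simp [hMg0.1, hg0]
    · simp [hMg0.2, hg1]
    · simp [h', hg2]
  · right
    ext l
    fin_cases l
    · simp [hMg0.1, hg0]
    · simp [hMg0.2, hg1]
    · simp [h', hg2]

/-- **The axis of a mirror-twin pair is unique up to sign.**  If two frames `L, L'` present the same
unordered pair `{L·Λ₀, L·Λ₀⁻} = {L'·Λ₀, L'·Λ₀⁻}` (either matching), then `L' e₃ = ± L e₃`. -/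
theorem twin_axis_unique (L L' : EuclideanSpace ℝ (Fin 3) ≃ₗᵢ[ℝ] EuclideanSpace ℝ (Fin 3))
    (h : (L' '' fccStacking 1 (Real.sqrt (2 / 3)) = L '' fccStacking 1 (Real.sqrt (2 / 3)) ∧
        L' '' barlowStacking 1 (Real.sqrt (2 / 3)) (fun _ : ℤ => (-1 : ℤ)) =
          L '' barlowStacking 1 (Real.sqrt (2 / 3)) (fun _ : ℤ => (-1 : ℤ))) ∨
      (L' '' fccStacking 1 (Real.sqrt (2 / 3)) = L '' barlowStacking 1 (Real.sqrt (2 / 3)) (fun _ : ℤ => (-1 : ℤ)) ∧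
        L' '' barlowStacking 1 (Real.sqrt (2 / 3)) (fun _ : ℤ => (-1 : ℤ)) =
          L '' fccStacking 1 (Real.sqrt (2 / 3)))) :
    L' (EuclideanSpace.single (2 : Fin 3) (1 : ℝ)) = L (EuclideanSpace.single (2 : Fin 3) (1 : ℝ)) ∨
    L' (EuclideanSpace.single (2 : Fin 3) (1 : ℝ)) = -L (EuclideanSpace.single (2 : Fin 3) (1 : ℝ)) := by
  set M : EuclideanSpace ℝ (Fin 3) ≃ₗᵢ[ℝ] EuclideanSpace ℝ (Fin 3) := L'.trans L.symm with hM
  have hMw : ∀ x, M x = L.symm (L' x) := fun x => rfl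
  have pull : ∀ S T : Set (EuclideanSpace ℝ (Fin 3)), L' '' S = L '' T → M '' S = T := by
    intro S T e
    have : M '' S = L.symm '' (L' '' S) := by
      rw [Set.image_image]; rfl
    rw [this, e, Set.image_image]
    simp
  have hM' := axis_of_frameClass_fixed M (by
    rcases h with ⟨e₁, e₂⟩ | ⟨e₁, e₂⟩
    · exact Or.inl ⟨pull _ _ e₁, pull _ _ e₂⟩
    · exact Or.inr ⟨pull _ _ e₁, pull _ _ e₂⟩)
  have back : ∀ x, L' x = L (M x) := fun x => by rw [hMw, LinearIsometryEquiv.apply_symm_apply]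
  rcases hM' with e | e
  · left; rw [back, e]
  · right; rw [back, e, map_neg]

end Summit.Ventures.Crystal3D.Theorems

end
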